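import Literature.AlgebraicGeometry.Frobenioids.Frobenioid
import Mathlib.Algebra.Group.Commute.Units
import HarnessLib

/-!
# Frobenioids I, Proposition 1.4: co-angular and LB-invertible morphisms
# (STEP-0 calibration fragment of the abc-iut cell — axiomatic-proof genre)

Mochizuki, *The geometry of Frobenioids I: the general theory*, Kyushu J. Math. **62** (2008)
293–400, §1, Proposition 1.4 "(Co-angular and LB-invertible Morphisms)" and its proof, kurims
text p. 25 (statement) – p. 26 (proof) [cite: MochizukiFrdI2008, Prop. 1.4]:

> "Let `Φ` be a divisorial monoid on a connected, totally epimorphic category `D`; `C → F_Φ` a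
> pre-Frobenioid; `φ : A → B` a morphism of `C`. Then: (i) Suppose that the codomain of any arrow
> of `C` whose domain is equal to `A` is isotropic. Then `φ` is co-angular. In particular, `φ` is a
> morphism of Frobenius type if and only if it is an isometric base-isomorphism. (ii) Suppose that
> `C` is a Frobenioid. Then `φ` is a pull-back morphism if and only if it is an LB-invertible
> linear morphism [i.e., a co-angular linear isometry]. (iii) Suppose that `C` is a Frobenioid.
> Then every LB-invertible pre-step is an isomorphism. (iv) Suppose that `C` is a Frobenioid.
> Then a morphism `φ` of `C` is co-angular if and only if, in the factorization `φ = α ∘ β ∘ γ` of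
> Definition 1.3, (iv), (a), the pre-step `β` is co-angular. (v) Suppose that `C` is a
> Frobenioid. Then a morphism `φ` of `C` is LB-invertible if and only if it is of the form
> `α ∘ β`, where `α` is a pull-back morphism, and `β` is a morphism of Frobenius type."

This is the first *axiomatic* proof of the paper (everything is derived from Definition 1.3 inside
an abstract Frobenioid, by "Remark 1.1.1" bookkeeping of `Base`, `Div`, `deg_Fr`). The Lean proof
follows the printed one step by step; the preliminary lemmas (isomorphisms are linear isometric
co-angular base-isomorphisms; compositions of linear / isometric / base-isomorphic arrows) are the
"formal" facts the text uses silently. Rendering notes: (iv) is stated for *every* factorisation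
as in Def. 1.3 (iv)(a) (the text's "the factorization" is unique up to isomorphism); in (iii) we
use the second of the two routes offered by the text (essential uniqueness of morphisms of
Frobenius type, Def. 1.3 (ii)), comparing `φ` with the identity. Arrows are composed in
diagrammatic order (`γ ≫ β ≫ α` is the text's `α ∘ β ∘ γ`). Also here: Remark 1.3.1 (`O^▷(A)` is
commutative in a Frobenioid, from Def. 1.3 (iii)(b)(c) exactly as printed). No statement of the
paper is strengthened.
-/

namespace Literature.AlgebraicGeometry.Frobenioids

open CategoryTheory Opposite

universe w v v' u u'

/-- In `N_{≥1}`, `m n = 1` forces `m = 1`. [folklore] -/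
private theorem pnat_eq_one_of_mul_eq_one_right' {m n : ℕ+} (h : m * n = 1) : m = 1 :=
  PNat.eq (by
    rw [PNat.one_coe]
    exact Nat.eq_one_of_mul_eq_one_right (by rw [← PNat.mul_coe, h, PNat.one_coe]))

/-- If `f ≫ g` and `g` are isomorphisms then so is `f`. [folklore] -/
private theorem isIso_of_isIso_comp_right' {D : Type u} [Category.{v} D] {X Y Z : D} (f : X ⟶ Y)
    (g : Y ⟶ Z) [IsIso g] [IsIso (f ≫ g)] : IsIso f := by
  have h : f = (f ≫ g) ≫ inv g := by rw [Category.assoc, IsIso.hom_inv_id, Category.comp_id]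
  rw [h]
  infer_instance

namespace PreFrobenioid

variable {D : Type u} [Category.{v} D] {Φ : Dᵒᵖ ⥤ CommMonCat.{w}}
  {C : Type u'} [Category.{v'} C] (F : C ⥤ ElemFrobenioid Φ)

/-! ### Isomorphisms of a pre-Frobenioid (used silently in the proof of Prop. 1.4) -/

/-- An isomorphism is linear: `deg_Fr(φ) · deg_Fr(φ⁻¹) = deg_Fr(id) = 1` (Remark 1.1.1).
[cite: MochizukiFrdI2008, Rem. 1.1.1] -/
theorem isLinear_of_isIso {A B : C} (φ : A ⟶ B) [IsIso φ] : IsLinear F φ :=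
  pnat_eq_one_of_mul_eq_one_right' (m := degFr F φ) (n := degFr F (inv φ))
    (by rw [← degFr_comp, IsIso.hom_inv_id, degFr_id])

/-- The zero divisor of an isomorphism is a unit (Remark 1.1.1 applied to `φ ∘ φ⁻¹ = id`).
[cite: MochizukiFrdI2008, Rem. 1.1.1] -/
theorem isUnit_div_of_isIso {A B : C} (φ : A ⟶ B) [IsIso φ] : IsUnit (Div F φ) := by
  have h : pull Φ (Base F φ) (Div F (inv φ)) * Div F φ ^ (degFr F (inv φ) : ℕ) = 1 := by
    rw [← div_comp, IsIso.hom_inv_id, div_id]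
  exact (isUnit_pow_iff (degFr F (inv φ)).ne_zero).mp (IsUnit.of_mul_eq_one_right _ h)

/-- In a pre-Frobenioid (`Φ` divisorial, hence sharp) an isomorphism is an isometry.
[cite: MochizukiFrdI2008, Rem. 1.1.1] -/
theorem isIsometry_of_isIso (hF : IsPreFrobenioid Φ F) {A B : C} (φ : A ⟶ B) [IsIso φ] :
    IsIsometry F φ :=
  (hF.isDivisorial (baseObj F A)).isSharp.eq_one_of_isUnit _ (isUnit_div_of_isIso F φ)

/-- An isomorphism is a pre-step. [cite: MochizukiFrdI2008, Def. 1.2(iii)] -/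
theorem isPreStep_of_isIso {A B : C} (φ : A ⟶ B) [IsIso φ] : IsPreStep F φ :=
  ⟨isLinear_of_isIso F φ, isBaseIso_of_isIso F φ⟩

/-- In a totally epimorphic category an isomorphism is co-angular: every factor of a
factorisation of an isomorphism is an isomorphism (FrdI §0 p. 16). [cite: MochizukiFrdI2008, Def. 1.2(iii)] -/
theorem isCoAngular_of_isIso (hC : IsTotallyEpimorphic C) {A B : C} (φ : A ⟶ B) [IsIso φ] :
    IsCoAngular F φ := by
  intro X Y γ β α h _ _ _ _
  haveI : IsIso (γ ≫ β ≫ α) := by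
    rw [h]
    infer_instance
  haveI : IsIso (β ≫ α) := (hC.isIso_of_isIso_comp γ (β ≫ α)).1
  exact (hC.isIso_of_isIso_comp β α).2

/-- In a pre-Frobenioid an isomorphism is a morphism of Frobenius type (of degree `1`).
[cite: MochizukiFrdI2008, Def. 1.2(iii)] -/
theorem isFrobeniusType_of_isIso (hF : IsPreFrobenioid Φ F) {A B : C} (φ : A ⟶ B) [IsIso φ] :
    IsFrobeniusType F φ :=
  ⟨⟨isCoAngular_of_isIso F hF.isTotallyEpimorphic φ, isIsometry_of_isIso F hF φ⟩,
    isBaseIso_of_isIso F φ⟩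

/-! ### Remark 1.1.1 bookkeeping for composites -/

/-- Linear ∘ linear is linear. [cite: MochizukiFrdI2008, Rem. 1.1.1] -/
theorem IsLinear.comp {X Y Z : C} {f : X ⟶ Y} {g : Y ⟶ Z} (hf : IsLinear F f) (hg : IsLinear F g) :
    IsLinear F (f ≫ g) := by
  show degFr F (f ≫ g) = 1
  rw [degFr_comp, show degFr F f = 1 from hf, show degFr F g = 1 from hg, mul_one]

/-- Base-isomorphism ∘ base-isomorphism is a base-isomorphism. [cite: MochizukiFrdI2008, Rem. 1.1.1] -/
theorem IsBaseIso.comp {X Y Z : C} {f : X ⟶ Y} {g : Y ⟶ Z} (hf : IsBaseIso F f)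
    (hg : IsBaseIso F g) : IsBaseIso F (f ≫ g) := by
  show IsIso (Base F (f ≫ g))
  rw [base_comp]
  haveI : IsIso (Base F f) := hf
  haveI : IsIso (Base F g) := hg
  infer_instance

/-- Isometry ∘ isometry is an isometry: `Div(g ∘ f) = Base(f)^* Div(g) + deg_Fr(g) · Div(f)`.
[cite: MochizukiFrdI2008, Rem. 1.1.1] -/
theorem IsIsometry.comp {X Y Z : C} {f : X ⟶ Y} {g : Y ⟶ Z} (hf : IsIsometry F f)
    (hg : IsIsometry F g) : IsIsometry F (f ≫ g) := by
  show Div F (f ≫ g) = 1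
  rw [div_comp, show Div F g = 1 from hg, map_one, show Div F f = 1 from hf, one_pow, mul_one]

/-- Pre-step ∘ pre-step is a pre-step. [cite: MochizukiFrdI2008, Rem. 1.1.1] -/
theorem IsPreStep.comp {X Y Z : C} {f : X ⟶ Y} {g : Y ⟶ Z} (hf : IsPreStep F f)
    (hg : IsPreStep F g) : IsPreStep F (f ≫ g) :=
  ⟨IsLinear.comp F hf.1 hg.1, IsBaseIso.comp F hf.2 hg.2⟩

/-! ### Proposition 1.4 -/

/-- **FrdI Prop. 1.4 (i)**: if the codomain of every arrow out of `A` is isotropic then every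
`φ : A → B` is co-angular ("follows formally from the definitions"). [cite: MochizukiFrdI2008, Prop. 1.4] -/
theorem isCoAngular_of_isIsotropic_codomains {A B : C} (φ : A ⟶ B)
    (h : ∀ ⦃X : C⦄ (_ : A ⟶ X), IsIsotropic F X) : IsCoAngular F φ :=
  fun _ _ γ β _ _ _ hβ₁ hβ₂ _ => h γ β hβ₁ hβ₂

/-- **FrdI Prop. 1.4 (i)**, "in particular": under the same hypothesis, `φ` is of Frobenius type
iff it is an isometric base-isomorphism. [cite: MochizukiFrdI2008, Prop. 1.4] -/
theorem isFrobeniusType_iff_of_isIsotropic_codomains {A B : C} (φ : A ⟶ B)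
    (h : ∀ ⦃X : C⦄ (_ : A ⟶ X), IsIsotropic F X) :
    IsFrobeniusType F φ ↔ IsIsometry F φ ∧ IsBaseIso F φ :=
  ⟨fun hφ => ⟨hφ.1.2, hφ.2⟩,
    fun hφ => ⟨⟨isCoAngular_of_isIsotropic_codomains F φ h, hφ.1⟩, hφ.2⟩⟩

/-- **FrdI Prop. 1.4 (ii)**: in a Frobenioid, `φ` is a pull-back morphism iff it is an
LB-invertible linear morphism. [cite: MochizukiFrdI2008, Prop. 1.4] -/
theorem isPullbackMorphism_iff_isLBInvertible_isLinear (hF : IsFrobenioid F) {A B : C}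
    (φ : A ⟶ B) : IsPullbackMorphism F φ ↔ IsLBInvertible F φ ∧ IsLinear F φ := by
  refine ⟨fun h => hF.iv_b φ h, fun ⟨⟨hco, hiso⟩, hlin⟩ => ?_⟩
  -- the factorisation of Def. 1.3 (iv)(a)
  obtain ⟨X, Y, γ, β, α, hfac, hγ, hβ, hα⟩ := hF.iv_a_exists φ
  obtain ⟨⟨_, hαiso⟩, hαlin⟩ := hF.iv_b α hα
  -- Remark 1.1.1, degrees: `γ` is linear
  have hdeg : degFr F γ * (degFr F β * degFr F α) = degFr F φ := by
    rw [← degFr_comp, ← degFr_comp, hfac]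
  rw [show degFr F β = 1 from hβ.1, show degFr F α = 1 from hαlin, show degFr F φ = 1 from hlin,
    mul_one, mul_one] at hdeg
  -- hence `β ∘ γ` is a pre-step …
  have hpre : IsPreStep F (γ ≫ β) := IsPreStep.comp F ⟨hdeg, hγ.2⟩ hβ
  -- … and, by Remark 1.1.1 for zero divisors, an isometry
  have hdiv : Div F φ = pull Φ (Base F (γ ≫ β)) (Div F α) * Div F (γ ≫ β) ^ (degFr F α : ℕ) := by
    rw [← div_comp, Category.assoc, hfac]
  rw [show Div F α = 1 from hαiso, map_one, one_mul, show degFr F α = 1 from hαlin, PNat.one_coe,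
    pow_one, show Div F φ = 1 from hiso] at hdiv
  have hisom : IsIsometry F (γ ≫ β) := hdiv.symm
  -- co-angularity of `φ = α ∘ (β ∘ γ) ∘ id` forces `β ∘ γ` to be an isomorphism
  haveI : IsIso (γ ≫ β) :=
    hco (𝟙 A) (γ ≫ β) α (by rw [Category.id_comp, Category.assoc, hfac]) hαlin hisom hpre
      (Or.inr (isBaseIso_of_isIso F (𝟙 A)))
  -- so `φ = α ∘ (isomorphism)` is a pull-back morphism
  rw [← hfac, ← Category.assoc]
  exact IsPullbackMorphism.comp F (isPullbackMorphism_of_isIso F (γ ≫ β)) hα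

/-- **FrdI Prop. 1.4 (iii)**: in a Frobenioid every LB-invertible pre-step is an isomorphism
(via the essential uniqueness of morphisms of Frobenius type of degree `1`, comparing with the
identity, and total epimorphicity). [cite: MochizukiFrdI2008, Prop. 1.4] -/
theorem isIso_of_isLBInvertible_of_isPreStep (hF : IsFrobenioid F) {A B : C} (φ : A ⟶ B)
    (h₁ : IsLBInvertible F φ) (h₂ : IsPreStep F φ) : IsIso φ := by
  have hC : IsTotallyEpimorphic C := hF.isPreFrobenioid.isTotallyEpimorphic
  have hφ : IsFrobeniusType F φ := ⟨h₁, h₂.2⟩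
  have hid : IsFrobeniusType F (𝟙 A) := isFrobeniusType_of_isIso F hF.isPreFrobenioid (𝟙 A)
  obtain ⟨β, hβ⟩ := hF.ii_unique φ (𝟙 A) hφ hid
    (by rw [show degFr F φ = 1 from h₂.1]; exact (degFr_id F A).symm)
  haveI : IsSplitMono φ := IsSplitMono.mk' ⟨β.hom, hβ⟩
  haveI : Epi φ := hC.epi φ
  exact isIso_of_epi_of_isSplitMono φ

/-- **FrdI Prop. 1.4 (iv)**: in a Frobenioid, for any factorisation `φ = α ∘ β ∘ γ` as in
Def. 1.3 (iv)(a), `φ` is co-angular iff the pre-step `β` is. [cite: MochizukiFrdI2008, Prop. 1.4] -/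
theorem isCoAngular_iff_of_factorization (hF : IsFrobenioid F) {A X Y B : C} (φ : A ⟶ B)
    (γ : A ⟶ X) (β : X ⟶ Y) (α : Y ⟶ B) (hfac : γ ≫ β ≫ α = φ) (hγ : IsFrobeniusType F γ)
    (hβ : IsPreStep F β) (hα : IsPullbackMorphism F α) : IsCoAngular F φ ↔ IsCoAngular F β := by
  obtain ⟨⟨hαco, _⟩, hαlin⟩ := hF.iv_b α hα
  constructor
  · intro hφ X' Y' β₃ β₂ β₁ hβfac hβ₁lin hβ₂iso hβ₂pre hor
    -- `β₃` is a base-isomorphism (from the hypothesis on `β₁` or `β₃` and `Base(β)` invertible)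
    have hβ₃ : IsBaseIso F β₃ := by
      rcases hor with h₁ | h₃
      · haveI : IsIso (Base F β₁) := h₁
        haveI : IsIso (Base F β₂) := hβ₂pre.2
        haveI : IsIso (Base F β₃ ≫ Base F β₂ ≫ Base F β₁) := by
          rw [← base_comp, ← base_comp, hβfac]
          exact hβ.2
        exact isIso_of_isIso_comp_right' (Base F β₃) (Base F β₂ ≫ Base F β₁)
      · exact h₃
    -- apply the co-angularity of `φ = (α ∘ β₁) ∘ β₂ ∘ (β₃ ∘ γ)`
    exact hφ (γ ≫ β₃) β₂ (β₁ ≫ α) (by rw [← hfac, ← hβfac]; simp only [Category.assoc])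
      (IsLinear.comp F hβ₁lin hαlin) hβ₂iso hβ₂pre (Or.inr (IsBaseIso.comp F hγ.2 hβ₃))
  · intro hβco
    rw [← hfac]
    exact hF.iii_a γ (β ≫ α) hγ.1.1 (hF.iii_a β α hβco hαco)

/-- **FrdI Prop. 1.4 (v)**: in a Frobenioid, `φ` is LB-invertible iff `φ = α ∘ β` with `α` a
pull-back morphism and `β` of Frobenius type. [cite: MochizukiFrdI2008, Prop. 1.4] -/
theorem isLBInvertible_iff_exists_factorization (hF : IsFrobenioid F) {A B : C} (φ : A ⟶ B) :
    IsLBInvertible F φ ↔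
      ∃ (X : C) (β : A ⟶ X) (α : X ⟶ B), β ≫ α = φ ∧ IsFrobeniusType F β ∧
        IsPullbackMorphism F α := by
  have hP : IsPreFrobenioid Φ F := hF.isPreFrobenioid
  constructor
  · rintro ⟨hco, hiso⟩
    obtain ⟨X, Y, γ, β, α, hfac, hγ, hβ, hα⟩ := hF.iv_a_exists φ
    obtain ⟨⟨hαco, hαiso⟩, hαlin⟩ := hF.iv_b α hα
    -- by (iv), `β` is co-angular
    have hβco : IsCoAngular F β :=
      (isCoAngular_iff_of_factorization F hF φ γ β α hfac hγ hβ hα).mp hco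
    -- by Remark 1.1.1, `β` is isometric
    have hdiv : Div F φ = pull Φ (Base F γ) (pull Φ (Base F β) (Div F α) * Div F β ^ (degFr F α : ℕ)) *
        Div F γ ^ (degFr F (β ≫ α) : ℕ) := by
      rw [← div_comp, ← div_comp, hfac]
    rw [show Div F α = 1 from hαiso, map_one, one_mul, show degFr F α = 1 from hαlin, PNat.one_coe,
      pow_one, show Div F γ = 1 from hγ.1.2, one_pow, mul_one, show Div F φ = 1 from hiso] at hdiv
    have hβiso : IsIsometry F β := by
      apply (hP.isMonoidOn.isCharInjective (Base F γ)).1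
      show pull Φ (Base F γ) (Div F β) = pull Φ (Base F γ) 1
      rw [map_one, ← hdiv]
    -- thus `β` is an LB-invertible pre-step, hence an isomorphism by (iii)
    haveI : IsIso β := isIso_of_isLBInvertible_of_isPreStep F hF β ⟨hβco, hβiso⟩ hβ
    refine ⟨Y, γ ≫ β, α, by rw [Category.assoc, hfac], ?_, hα⟩
    exact ⟨⟨hF.iii_a γ β hγ.1.1 (isCoAngular_of_isIso F hP.isTotallyEpimorphic β),
      IsIsometry.comp F hγ.1.2 (isIsometry_of_isIso F hP β)⟩,
      IsBaseIso.comp F hγ.2 (isBaseIso_of_isIso F β)⟩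
  · rintro ⟨X, β, α, hfac, hβ, hα⟩
    obtain ⟨⟨hαco, hαiso⟩, _⟩ := hF.iv_b α hα
    rw [← hfac]
    exact ⟨hF.iii_a β α hβ.1.1 hαco, IsIsometry.comp F hβ.1.2 hαiso⟩

/-! ### Remark 1.3.1: `O^▷(A)` is commutative -/

/-- In a Frobenioid every endomorphism is co-angular: Def. 1.3 (iii)(b) applied to the identity,
which is a co-angular pre-step. [cite: MochizukiFrdI2008, Def. 1.3(iii)] -/
theorem isCoAngular_endo (hF : IsFrobenioid F) {A : C} (ψ : A ⟶ A) : IsCoAngular F ψ :=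
  hF.iii_b (𝟙 A) ⟨isCoAngular_of_isIso F hF.isPreFrobenioid.isTotallyEpimorphic (𝟙 A),
    isPreStep_of_isIso F (𝟙 A)⟩ ψ

/-- **FrdI Remark 1.3.1**: "it follows from Definition 1.3, (iii), (b), (c), that if `C` is a
Frobenioid, then the monoid `O^▷(A)` is commutative" — the bijection of (iii)(c) attached to
`a ∈ O^▷(A)` coincides, by the dependence on `Base(a) = id` only, with the one attached to the
identity, which is the identity. [cite: MochizukiFrdI2008, Rem. 1.3.1] -/
theorem endSubmonoid_comm (hF : IsFrobenioid F) {A : C} (a b : endSubmonoid F A) : a * b = b * a := by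
  have ha : IsCoAngularPreStep F (show A ⟶ A from a.1) :=
    ⟨isCoAngular_endo F hF _, a.2.2, by
      have h : Base F (show A ⟶ A from a.1) = 𝟙 _ := a.2.1
      show IsIso (Base F (show A ⟶ A from a.1))
      rw [h]
      infer_instance⟩
  have hid : IsCoAngularPreStep F (𝟙 A) :=
    ⟨isCoAngular_of_isIso F hF.isPreFrobenioid.isTotallyEpimorphic (𝟙 A), isPreStep_of_isIso F (𝟙 A)⟩
  obtain ⟨e, he⟩ := hF.iii_c (show A ⟶ A from a.1) ha
  have hb : Base F (show A ⟶ A from a.1) = Base F (𝟙 A) := by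
    rw [show Base F (show A ⟶ A from a.1) = 𝟙 _ from a.2.1, base_id]
  have key : e b = b :=
    hF.iii_c_base (show A ⟶ A from a.1) (𝟙 A) ha hid hb b (e b) b (he b)
      (by rw [Category.comp_id, Category.id_comp])
  have hab : (show A ⟶ A from a.1) ≫ (show A ⟶ A from b.1) =
      (show A ⟶ A from b.1) ≫ (show A ⟶ A from a.1) := by
    have h := he b
    rw [key] at h
    exact h
  exact Subtype.ext hab.symm

end PreFrobenioid

end Literature.AlgebraicGeometry.Frobenioids
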